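import Mathlib
import HarnessLib
import Literature.NumberTheory.LFunctions.CriticalLineTwoThirds
import Literature.NumberTheory.LFunctions.CriticalLineTwoThirdsProofs

/-!
# RH-FREE — Alpöge–Furman 2026, Lemma 3.1 (inertia under pull-back), PROVED,
# with both directions of Sylvester's law of inertia for the positive index `n₊`

Topic `Literature/NumberTheory/LFunctions` (namespace `Literature.NumberTheory.LFunctions`; helper
lemmas in the sub-namespace `AlpogeFurman2026.Inertia`). PROOF LAYER for the statement file
`CriticalLineTwoThirds.lean`, whose `posEigenvalueCount hQ = n₊(Q)` counts the strictly positive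
eigenvalues of a Hermitian matrix (read off Mathlib's `Matrix.IsHermitian.eigenvalues`).

* `AlpogeFurman2026.Inertia.finrank_le_posEigenvalueCount` — if the Hermitian form `x ↦ xᴴ Q x` is
  positive definite on a subspace `W`, then `dim W ≤ n₊(Q)` (one direction of Sylvester's law of
  inertia);
* `AlpogeFurman2026.Inertia.exists_posDef_subspace` — there is a subspace of dimension `n₊(Q)` on
  which the form is positive definite (the other direction);
* `AlpogeFurman2026_inertia_pullback` — **[AF26] Lemma 3.1**: for `Q₀` Hermitian `m × m` and
  `A : ℂ^d → ℂ^m` (an `m × d` matrix), `n₊(Aᴴ Q₀ A) ≤ n₊(Q₀)` ("If `Q₀ ∘ A` is positive definite on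
  a subspace `U ⊂ ℂ^d`, then `A|_U` is injective and `Q₀` is positive definite on `A(U)`; hence
  `dim U = dim A(U) ≤ n₊(Q₀)`", the printed proof, p. 5);
* `AlpogeFurman2026.Inertia.posEigenvalueCount_add_finrank_le` — the complement form
  `n₊(Q) ≤ codim K` whenever the form is `≤ 0` on `K`;
* `AlpogeFurman2026_offline_blocks` (with `AlpogeFurman2026.offlineBlocks_isHermitian`) — the
  off-line bound in the proof of **[AF26] Proposition 4.1** at matrix level: a sum of `#κ` weighted
  signature-`(1,1)` blocks `Σ_k m_k (a_k a_kᴴ − b_k b_kᴴ)`, `m_k ≥ 0`, has `n₊ ≤ #κ` (in the paper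
  `κ` = the off-line pairs `{ρ, 1 − ρ̄}`, `v_ρ = a + ib`, so `n₊(Q) ≤ ½ #off`);
* `AlpogeFurman2026.onLine_posSemidef`, `AlpogeFurman2026.onLine_rank_le` — the on-line part of
  Proposition 4.1: `P = Σ_j μ_j v_j v_jᴴ`, `μ_j ≥ 0`, is `⪰ 0` of rank `≤ #ι`;
* `AlpogeFurman2026_block_certificate` — the assembled linear-algebra certificate
  `#ι ≥ 2 tr P + 4 tr Q − 4 #κ − ‖P + Q‖²_HS` (Lemma 3.2, proved in
  `CriticalLineTwoThirdsProofs.lean` as `AlpogeFurman2026_rank_trace_holds`, fed with the block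
  structure above).

These are the "both directions of Sylvester's law of inertia for Hermitian forms" that [AF26]
report contributing to their own repository (App. A, p. 16); they are the step
(Z) ⇒ `n₊(Q) ≤ ½ #off` of Proposition 4.1. Together with `AlpogeFurman2026_rank_trace_holds`
(`CriticalLineTwoThirdsProofs.lean`) the finite-dimensional part of the [AF26] certificate is now
kernel-checked in this tree. Nothing here bears on the analytic inputs or on the truth of RH.
«The programme SEARCHES and TYPES; no claim about Landau–Siegel zeros, Theorems 1–2 of
arXiv:2211.02515 or a repaired Margin232 until a kernel theorem says so.»

## References

* [AF26] L. Alpöge, R. Furman, *More than two thirds of the zeros of the Riemann zeta function are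
  simple and on the critical line*, arXiv:2608.13637v2 (2026), Lemma 3.1 (p. 5), Proposition 4.1
  (p. 6), Appendix A (p. 16). [key `AlpogeFurman2026`]
-/

open Matrix Complex Finset Module
open scoped ComplexOrder

namespace Literature.NumberTheory.LFunctions

namespace AlpogeFurman2026.Inertia

variable {n : Type*} [Fintype n] [DecidableEq n]

omit [DecidableEq n] in
/-- Pull-back of a Hermitian form: `xᴴ (Bᴴ D B) x = (Bx)ᴴ D (Bx)`. [folklore] -/
private theorem quadForm_conj {m : Type*} [Fintype m] (B : Matrix m n ℂ) (D : Matrix m m ℂ)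
    (x : n → ℂ) : star x ⬝ᵥ ((Bᴴ * D * B) *ᵥ x) = star (B *ᵥ x) ⬝ᵥ (D *ᵥ (B *ᵥ x)) := by
  rw [← mulVec_mulVec, ← mulVec_mulVec, dotProduct_mulVec, star_mulVec]

/-- Diagonalisation of the Hermitian form: `xᴴ A x = Σᵢ λᵢ |cᵢ|²`, `c = U* x`. [folklore] -/
private theorem quadForm_eq_sum {A : Matrix n n ℂ} (hA : A.IsHermitian) (x : n → ℂ) :
    star x ⬝ᵥ (A *ᵥ x) =
      ∑ i, (hA.eigenvalues i : ℂ) *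
        (‖(star (hA.eigenvectorUnitary : Matrix n n ℂ) *ᵥ x) i‖ ^ 2 : ℝ) := by
  set U : Matrix n n ℂ := (hA.eigenvectorUnitary : Matrix n n ℂ) with hUdef
  have hspec : A = (star U)ᴴ * diagonal (fun i ↦ ((hA.eigenvalues i : ℝ) : ℂ)) * star U := by
    have h := hA.spectral_theorem
    rw [Unitary.conjStarAlgAut_apply] at h
    rw [star_eq_conjTranspose, conjTranspose_conjTranspose, ← star_eq_conjTranspose]
    exact h
  conv_lhs => rw [hspec, quadForm_conj]
  set c := star U *ᵥ x
  simp only [dotProduct, mulVec_diagonal, Pi.star_apply]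
  refine Finset.sum_congr rfl fun i _ ↦ ?_
  rw [← mul_assoc, mul_comm (star (c i)), mul_assoc, Complex.star_def, Complex.conj_mul',
    Complex.ofReal_pow]

/-- **Sylvester, upper bound.** If `xᴴ A x` has positive real part for every non-zero `x` of a
subspace `W`, then `dim W ≤ n₊(A)`. [cite: AlpogeFurman2026, Lemma 3.1 (p. 5) and App. A (p. 16)] -/
theorem finrank_le_posEigenvalueCount {A : Matrix n n ℂ} (hA : A.IsHermitian)
    (W : Submodule ℂ (n → ℂ)) (hW : ∀ x ∈ W, x ≠ 0 → 0 < (star x ⬝ᵥ (A *ᵥ x)).re) :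
    finrank ℂ W ≤ posEigenvalueCount hA := by
  classical
  set U : Matrix n n ℂ := (hA.eigenvectorUnitary : Matrix n n ℂ) with hUdef
  set S : Finset n := Finset.univ.filter fun i ↦ 0 < hA.eigenvalues i with hSdef
  have hcount : posEigenvalueCount hA = S.card := rfl
  -- the coordinate map onto the positive eigen-coordinates
  let φ : (n → ℂ) →ₗ[ℂ] (S → ℂ) :=
    { toFun := fun x i ↦ (star U *ᵥ x) i.1
      map_add' := fun x y ↦ by funext i; simp [mulVec_add]
      map_smul' := fun a x ↦ by funext i; simp [mulVec_smul] }
  -- its kernel has codimension at most `|S|`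
  have hker : Fintype.card n ≤ finrank ℂ (LinearMap.ker φ) + S.card := by
    have h1 := φ.finrank_range_add_finrank_ker
    have h2 : finrank ℂ (LinearMap.range φ) ≤ S.card := by
      calc finrank ℂ (LinearMap.range φ) ≤ finrank ℂ (S → ℂ) := Submodule.finrank_le _
        _ = S.card := by rw [Module.finrank_fintype_fun_eq_card, Fintype.card_coe]
    rw [Module.finrank_fintype_fun_eq_card] at h1
    omega
  -- on the kernel the form is `≤ 0`
  have hneg : ∀ x ∈ LinearMap.ker φ, (star x ⬝ᵥ (A *ᵥ x)).re ≤ 0 := by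
    intro x hx
    rw [LinearMap.mem_ker] at hx
    rw [quadForm_eq_sum hA x, Complex.re_sum]
    refine Finset.sum_nonpos fun i _ ↦ ?_
    rw [← Complex.ofReal_mul, Complex.ofReal_re]
    by_cases hi : 0 < hA.eigenvalues i
    · have hxi : (star U *ᵥ x) i = 0 := by
        have := congrFun hx ⟨i, by simp [hSdef, hi]⟩
        exact this
      rw [← hUdef, hxi]
      simp
    · exact mul_nonpos_of_nonpos_of_nonneg (not_lt.1 hi) (by positivity)
  -- dimension count
  by_contra hlt
  push Not at hlt
  rw [hcount] at hlt
  have hsum := Submodule.finrank_sup_add_finrank_inf_eq W (LinearMap.ker φ)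
  have hsup : finrank ℂ ↥(W ⊔ LinearMap.ker φ) ≤ Fintype.card n := by
    calc finrank ℂ ↥(W ⊔ LinearMap.ker φ) ≤ finrank ℂ (n → ℂ) := Submodule.finrank_le _
      _ = Fintype.card n := Module.finrank_fintype_fun_eq_card ℂ
  have hinf : 0 < finrank ℂ ↥(W ⊓ LinearMap.ker φ) := by omega
  have hne : W ⊓ LinearMap.ker φ ≠ ⊥ := by
    intro h
    rw [h, finrank_bot] at hinf
    exact lt_irrefl _ hinf
  obtain ⟨x, hx, hx0⟩ := (Submodule.ne_bot_iff _).1 hne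
  have h1 := hW x (Submodule.mem_inf.1 hx).1 hx0
  have h2 := hneg x (Submodule.mem_inf.1 hx).2
  linarith


/-- **Sylvester, attained.** There is a subspace of dimension `n₊(A)` on which `xᴴ A x` is positive
definite (the span of the eigenvectors with positive eigenvalue).
[cite: AlpogeFurman2026, Lemma 3.1 (p. 5) and App. A (p. 16)] -/
theorem exists_posDef_subspace {A : Matrix n n ℂ} (hA : A.IsHermitian) :
    ∃ W : Submodule ℂ (n → ℂ), finrank ℂ W = posEigenvalueCount hA ∧
      ∀ x ∈ W, x ≠ 0 → 0 < (star x ⬝ᵥ (A *ᵥ x)).re := by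
  classical
  set U : Matrix n n ℂ := (hA.eigenvectorUnitary : Matrix n n ℂ) with hUdef
  set S : Finset n := Finset.univ.filter fun i ↦ 0 < hA.eigenvalues i with hSdef
  have hcount : posEigenvalueCount hA = S.card := rfl
  have hU : star U * U = 1 := Unitary.star_mul_self_of_mem hA.eigenvectorUnitary.prop
  -- extension by zero from the positive coordinates, followed by `U`
  let ext : (S → ℂ) →ₗ[ℂ] (n → ℂ) :=
    { toFun := fun c i ↦ if h : i ∈ S then c ⟨i, h⟩ else 0
      map_add' := fun c c' ↦ by funext i; by_cases h : i ∈ S <;> simp [h]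
      map_smul' := fun a c ↦ by funext i; by_cases h : i ∈ S <;> simp [h] }
  let ψ : (S → ℂ) →ₗ[ℂ] (n → ℂ) := (mulVecLin U).comp ext
  have hψ : ∀ c, star U *ᵥ ψ c = ext c := fun c ↦ by
    change star U *ᵥ (U *ᵥ ext c) = ext c
    rw [mulVec_mulVec, hU, one_mulVec]
  have hinj : Function.Injective ψ := by
    rw [← LinearMap.ker_eq_bot, LinearMap.ker_eq_bot']
    intro c hc
    have h0 : ext c = 0 := by rw [← hψ c, hc, mulVec_zero]
    funext j
    have := congrFun h0 j.1
    simpa [ext, j.2] using this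
  refine ⟨LinearMap.range ψ, by rw [LinearMap.finrank_range_of_inj hinj, hcount,
    Module.finrank_fintype_fun_eq_card, Fintype.card_coe], ?_⟩
  rintro x ⟨c, rfl⟩ hx
  have hc : c ≠ 0 := by rintro rfl; exact hx (map_zero ψ)
  obtain ⟨j, hj⟩ : ∃ j, c j ≠ 0 := by
    by_contra h
    push Not at h
    exact hc (funext h)
  rw [quadForm_eq_sum hA, ← hUdef, hψ c, Complex.re_sum]
  simp_rw [← Complex.ofReal_mul, Complex.ofReal_re]
  refine Finset.sum_pos' (fun i _ ↦ ?_) ⟨j.1, Finset.mem_univ _, ?_⟩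
  · by_cases hi : i ∈ S
    · exact mul_nonneg (le_of_lt (by simpa [hSdef] using hi)) (by positivity)
    · simp [ext, hi]
  · have hj' : 0 < hA.eigenvalues j.1 := by
      have h : (j.1 : n) ∈ S := j.2
      exact (Finset.mem_filter.1 h).2
    refine mul_pos hj' (pow_pos (norm_pos_iff.2 ?_) 2)
    simpa [ext, j.2] using hj

end AlpogeFurman2026.Inertia

open AlpogeFurman2026.Inertia in
/-- **[AF26] Lemma 3.1 (inertia under pull-back).** If `Q₀ : ℂ^m → ℂ^m` is Hermitian and
`A : ℂ^d → ℂ^m` is linear, then `n₊(Aᴴ Q₀ A) ≤ n₊(Q₀)`. The printed proof: `Q₀ ∘ A` positive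
definite on `U` forces `A|_U` injective and `Q₀` positive definite on `A(U)`, so
`dim U = dim A(U) ≤ n₊(Q₀)`.
[cite: AlpogeFurman2026, Lemma 3.1, p. 5] -/
theorem AlpogeFurman2026_inertia_pullback {m d : Type*} [Fintype m] [DecidableEq m] [Fintype d]
    [DecidableEq d] {Q₀ : Matrix m m ℂ} (hQ₀ : Q₀.IsHermitian) (A : Matrix m d ℂ)
    (hQ : (Aᴴ * Q₀ * A).IsHermitian) : posEigenvalueCount hQ ≤ posEigenvalueCount hQ₀ := by
  obtain ⟨W, hW, hpos⟩ := exists_posDef_subspace hQ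
  -- `A` is injective on `W`
  have hinj : ∀ x ∈ W, A *ᵥ x = 0 → x = 0 := by
    intro x hx h0
    by_contra hne
    have := hpos x hx hne
    rw [quadForm_conj, h0, star_zero, zero_dotProduct, Complex.zero_re] at this
    exact lt_irrefl _ this
  -- hence `dim W = dim A(W)`
  have hdim : finrank ℂ ↥(W.map (mulVecLin A)) = finrank ℂ W := by
    have hker : LinearMap.ker ((mulVecLin A).domRestrict W) = ⊥ := by
      rw [LinearMap.ker_eq_bot']
      rintro ⟨x, hx⟩ h0
      exact Subtype.ext (hinj x hx h0)
    have h := LinearMap.finrank_range_of_inj (LinearMap.ker_eq_bot.1 hker)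
    rw [LinearMap.range_domRestrict] at h
    exact h
  -- and `Q₀` is positive definite on `A(W)`
  rw [← hW, ← hdim]
  refine finrank_le_posEigenvalueCount hQ₀ _ ?_
  rintro _ ⟨x, hx, rfl⟩ hy
  have hx0 : x ≠ 0 := by rintro rfl; exact hy (map_zero _)
  have := hpos x hx hx0
  rwa [quadForm_conj] at this

/-! ## The off-line blocks of [AF26] Proposition 4.1: `n₊(Σ_k m_k (a_k a_kᴴ − b_k b_kᴴ)) ≤ #k` -/

namespace AlpogeFurman2026.Inertia

variable {n : Type*} [Fintype n] [DecidableEq n]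

/-- **Sylvester, complement form.** If `xᴴ A x` has non-positive real part on a subspace `K`, then
`n₊(A) + dim K ≤ dim`, i.e. `n₊(A) ≤ codim K`.
[cite: AlpogeFurman2026, Lemma 3.1 (p. 5) and App. A (p. 16)] -/
theorem posEigenvalueCount_add_finrank_le {A : Matrix n n ℂ} (hA : A.IsHermitian)
    (K : Submodule ℂ (n → ℂ)) (hK : ∀ x ∈ K, (star x ⬝ᵥ (A *ᵥ x)).re ≤ 0) :
    posEigenvalueCount hA + finrank ℂ K ≤ Fintype.card n := by
  obtain ⟨W, hW, hpos⟩ := exists_posDef_subspace hA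
  have hinf : W ⊓ K = ⊥ := by
    rw [Submodule.eq_bot_iff]
    intro x hx
    by_contra h0
    have h1 := hpos x (Submodule.mem_inf.1 hx).1 h0
    have h2 := hK x (Submodule.mem_inf.1 hx).2
    linarith
  have hsum := Submodule.finrank_sup_add_finrank_inf_eq W K
  rw [hinf, finrank_bot, add_zero] at hsum
  have hsup : finrank ℂ ↥(W ⊔ K) ≤ Fintype.card n := by
    calc finrank ℂ ↥(W ⊔ K) ≤ finrank ℂ (n → ℂ) := Submodule.finrank_le _
      _ = Fintype.card n := Module.finrank_fintype_fun_eq_card ℂ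
  omega

omit [DecidableEq n] in
/-- The rank-one form: `xᴴ (a aᴴ) x = |aᴴ x|²`. [folklore] -/
private theorem form_rankOne (a x : n → ℂ) :
    star x ⬝ᵥ (vecMulVec a (star a) *ᵥ x) = ((‖star a ⬝ᵥ x‖ ^ 2 : ℝ) : ℂ) := by
  rw [vecMulVec_mulVec, IsCentralScalar.op_smul_eq_smul, dotProduct_smul, star_dotProduct x a,
    smul_eq_mul, Complex.star_def, Complex.mul_conj', Complex.ofReal_pow]

omit [DecidableEq n] in
/-- The Hermitian form of a sum of weighted signature-`(1,1)` blocks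
`Σ_k m_k (a_k a_kᴴ − b_k b_kᴴ)` is `Σ_k m_k (|a_kᴴ x|² − |b_kᴴ x|²)`. [folklore] -/
private theorem form_blocks {κ : Type*} [Fintype κ] (m : κ → ℝ) (a b : κ → n → ℂ) (x : n → ℂ) :
    star x ⬝ᵥ ((∑ k, m k • (vecMulVec (a k) (star (a k)) - vecMulVec (b k) (star (b k)))) *ᵥ x) =
      ((∑ k, m k * (‖star (a k) ⬝ᵥ x‖ ^ 2 - ‖star (b k) ⬝ᵥ x‖ ^ 2) : ℝ) : ℂ) := by
  rw [sum_mulVec, dotProduct_sum, Complex.ofReal_sum]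
  refine Finset.sum_congr rfl fun k _ ↦ ?_
  rw [smul_mulVec, dotProduct_smul, sub_mulVec, dotProduct_sub, form_rankOne, form_rankOne,
    Complex.real_smul]
  push_cast
  ring

end AlpogeFurman2026.Inertia

/-- The off-line-pair matrix `Σ_k m_k (a_k a_kᴴ − b_k b_kᴴ)` (real weights `m_k`) is Hermitian.
[cite: AlpogeFurman2026, Proposition 4.1 (proof), p. 6] -/
theorem AlpogeFurman2026.offlineBlocks_isHermitian {d κ : Type*} [Fintype κ] (m : κ → ℝ)
    (a b : κ → d → ℂ) :
    (∑ k, m k • (vecMulVec (a k) (star (a k)) - vecMulVec (b k) (star (b k)))).IsHermitian := by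
  have h1 : ∀ v : d → ℂ, (vecMulVec v (star v))ᴴ = vecMulVec v (star v) := fun v ↦ by
    ext i j
    simp [vecMulVec_apply, conjTranspose_apply, mul_comm]
  unfold Matrix.IsHermitian
  rw [conjTranspose_sum]
  refine Finset.sum_congr rfl fun k _ ↦ ?_
  rw [conjTranspose_smul, conjTranspose_sub, h1, h1, star_trivial]

open AlpogeFurman2026.Inertia in
/-- **[AF26] Proposition 4.1, off-line bound (matrix form).** A sum of `#κ` weighted
signature-`(1,1)` blocks `Q = Σ_k m_k (a_k a_kᴴ − b_k b_kᴴ)` with `m_k ≥ 0` has positive index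
`n₊(Q) ≤ #κ`: `Q` is the pull-back of `⊕_k m_k·diag(1,−1)` under `x ↦ (a_kᴴ x, b_kᴴ x)_k`, whose
positive index is at most the number of blocks (the paper then applies Lemma 3.1; here the bound
is read off `posEigenvalueCount_add_finrank_le` with `K = ⋂_k ker(a_kᴴ ·)`). In [AF26] the blocks
are the off-line pairs `{ρ, 1 − ρ̄}` with `v_ρ = a + i b` and `m_ρ` the multiplicity, giving
`n₊(Q) ≤ ½ #off`.
[cite: AlpogeFurman2026, Proposition 4.1 (proof, off-line bound), p. 6] -/
theorem AlpogeFurman2026_offline_blocks {d κ : Type*} [Fintype d] [DecidableEq d] [Fintype κ]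
    (m : κ → ℝ) (hm : ∀ k, 0 ≤ m k) (a b : κ → d → ℂ)
    (hQ : (∑ k, m k • (vecMulVec (a k) (star (a k)) - vecMulVec (b k) (star (b k)))).IsHermitian) :
    posEigenvalueCount hQ ≤ Fintype.card κ := by
  classical
  -- the map `x ↦ (a_kᴴ x)_k`
  let φ : (d → ℂ) →ₗ[ℂ] (κ → ℂ) :=
    { toFun := fun x k ↦ star (a k) ⬝ᵥ x
      map_add' := fun x y ↦ by funext k; simp [dotProduct_add]
      map_smul' := fun c x ↦ by funext k; simp [dotProduct_smul] }
  -- on its kernel the form is `≤ 0`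
  have hK : ∀ x ∈ LinearMap.ker φ, (star x ⬝ᵥ ((∑ k, m k • (vecMulVec (a k) (star (a k)) -
      vecMulVec (b k) (star (b k)))) *ᵥ x)).re ≤ 0 := by
    intro x hx
    rw [LinearMap.mem_ker] at hx
    rw [form_blocks, Complex.ofReal_re]
    refine Finset.sum_nonpos fun k _ ↦ mul_nonpos_of_nonneg_of_nonpos (hm k) ?_
    have hk : star (a k) ⬝ᵥ x = 0 := congrFun hx k
    rw [hk, norm_zero, zero_pow two_ne_zero, zero_sub, neg_nonpos]
    positivity
  have h1 := posEigenvalueCount_add_finrank_le hQ (LinearMap.ker φ) hK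
  have h2 := φ.finrank_range_add_finrank_ker
  have h3 : finrank ℂ (LinearMap.range φ) ≤ Fintype.card κ := by
    calc finrank ℂ (LinearMap.range φ) ≤ finrank ℂ (κ → ℂ) := Submodule.finrank_le _
      _ = Fintype.card κ := Module.finrank_fintype_fun_eq_card ℂ
  rw [Module.finrank_fintype_fun_eq_card] at h2
  omega

/-! ## The on-line part of [AF26] Proposition 4.1 and the assembled certificate -/

namespace AlpogeFurman2026.Inertia

variable {n : Type*} [Fintype n]

/-- The Hermitian form of the on-line matrix `Σ_j μ_j v_j v_jᴴ` is `Σ_j μ_j |v_jᴴ x|²`.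
[folklore] -/
private theorem form_onLine {ι : Type*} [Fintype ι] (μ : ι → ℝ) (v : ι → n → ℂ) (x : n → ℂ) :
    star x ⬝ᵥ ((∑ j, μ j • vecMulVec (v j) (star (v j))) *ᵥ x) =
      ((∑ j, μ j * ‖star (v j) ⬝ᵥ x‖ ^ 2 : ℝ) : ℂ) := by
  rw [sum_mulVec, dotProduct_sum, Complex.ofReal_sum]
  refine Finset.sum_congr rfl fun j _ ↦ ?_
  rw [smul_mulVec, dotProduct_smul, form_rankOne, Complex.real_smul]
  push_cast
  ring

end AlpogeFurman2026.Inertia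

open AlpogeFurman2026.Inertia in
/-- The on-line matrix `P = Σ_j μ_j v_j v_jᴴ` with weights `μ_j ≥ 0` is positive semidefinite.
[cite: AlpogeFurman2026, Proposition 4.1 (proof, on-line part), p. 6] -/
theorem AlpogeFurman2026.onLine_posSemidef {d ι : Type*} [Fintype d] [Fintype ι] (μ : ι → ℝ)
    (hμ : ∀ j, 0 ≤ μ j) (v : ι → d → ℂ) :
    (∑ j, μ j • vecMulVec (v j) (star (v j))).PosSemidef := by
  refine posSemidef_iff_dotProduct_mulVec.2 ⟨?_, fun x ↦ ?_⟩
  · have h1 : ∀ w : d → ℂ, (vecMulVec w (star w))ᴴ = vecMulVec w (star w) := fun w ↦ by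
      ext i j
      simp [vecMulVec_apply, conjTranspose_apply, mul_comm]
    unfold Matrix.IsHermitian
    rw [conjTranspose_sum]
    refine Finset.sum_congr rfl fun j _ ↦ ?_
    rw [conjTranspose_smul, h1, star_trivial]
  · rw [form_onLine]
    exact Complex.zero_le_real.2 (Finset.sum_nonneg fun j _ ↦ mul_nonneg (hμ j) (by positivity))

/-- The on-line matrix `P = Σ_j μ_j v_j v_jᴴ` has rank at most the number `#ι` of summands
(it factors through `ℂ^ι`). [cite: AlpogeFurman2026, Proposition 4.1 (proof, on-line part), p. 6] -/
theorem AlpogeFurman2026.onLine_rank_le {d ι : Type*} [Fintype d] [Fintype ι] (μ : ι → ℝ)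
    (v : ι → d → ℂ) :
    (∑ j, μ j • vecMulVec (v j) (star (v j))).rank ≤ Fintype.card ι := by
  classical
  let A : Matrix d ι ℂ := fun i j ↦ (μ j : ℂ) * v j i
  let B : Matrix ι d ℂ := fun j i ↦ star (v j i)
  have hP : (∑ j, μ j • vecMulVec (v j) (star (v j))) = A * B := by
    ext i i'
    simp only [Matrix.sum_apply, Matrix.smul_apply, vecMulVec_apply, Pi.star_apply, mul_apply, A, B,
      Complex.real_smul]
    refine Finset.sum_congr rfl fun j _ ↦ ?_
    ring
  rw [hP]
  exact (rank_mul_le_left A B).trans (rank_le_card_width A)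

open AlpogeFurman2026 AlpogeFurman2026.Inertia in
/-- **[AF26] §§3–4, the linear-algebra certificate assembled** (Lemma 3.2 fed with Proposition 4.1's
block structure, both now theorems of this tree): for on-line data `(μ_j ≥ 0, v_j)_{j ∈ ι}` and
off-line pair data `(m_k ≥ 0, a_k, b_k)_{k ∈ κ}` in `ℂ^d`, with `P = Σ_j μ_j v_j v_jᴴ` and
`Q = Σ_k m_k (a_k a_kᴴ − b_k b_kᴴ)`,
`#ι ≥ 2 tr P + 4 tr Q − 4 #κ − ‖P + Q‖²_HS`.
In [AF26] `#ι = N₀*(I')` (distinct on-line zeros), `#κ = ½ #off`, and `P + Q` is the zero side of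
the compressed explicit formula; the analytic evaluation of the traces is NOT part of this theorem.
[cite: AlpogeFurman2026, Lemma 3.2 (p. 5) with Proposition 4.1 (p. 6)] -/
theorem AlpogeFurman2026_block_certificate (d : ℕ) {ι κ : Type*} [Fintype ι] [Fintype κ]
    (μ : ι → ℝ) (hμ : ∀ j, 0 ≤ μ j) (v : ι → Fin d → ℂ)
    (m : κ → ℝ) (hm : ∀ k, 0 ≤ m k) (a b : κ → Fin d → ℂ) :
    2 * ((∑ j, μ j • vecMulVec (v j) (star (v j))).trace).re +
      4 * ((∑ k, m k • (vecMulVec (a k) (star (a k)) - vecMulVec (b k) (star (b k)))).trace).re -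
      4 * (Fintype.card κ : ℝ) -
      ((((∑ j, μ j • vecMulVec (v j) (star (v j))) +
          (∑ k, m k • (vecMulVec (a k) (star (a k)) - vecMulVec (b k) (star (b k))))) *
        ((∑ j, μ j • vecMulVec (v j) (star (v j))) +
          (∑ k, m k • (vecMulVec (a k) (star (a k)) - vecMulVec (b k) (star (b k)))))).trace).re ≤
      (Fintype.card ι : ℝ) :=
  AlpogeFurman2026_rank_trace_holds d _ _ (onLine_posSemidef μ hμ v)
    (offlineBlocks_isHermitian m a b) (Fintype.card ι) (Fintype.card κ) (onLine_rank_le μ v)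
    (AlpogeFurman2026_offline_blocks m hm a b _)

end Literature.NumberTheory.LFunctions
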